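import Summits.FinalStateConjecture.FinalStateConjecture.Theses.KillingDefectSpacetimeBound

set_option linter.dupNamespace false

/-!
# Birth skeleton (BC3) for crux `RecurrentKerrEraWithBudgets` (stmt-FinalStateConjecture-18633) of route
`KillingDefectSpacetimeBound` — file `Cruxes/RecurrentKerrEraWithBudgets/Lines/birth.lean`
(planner-skel-stmt-FinalStateConjecture-18633-0, skeleton-register, 2026-08-17)

The crux R (rank 5, difficulty open-problem; the route's ONE generic statement, OmegaLimit device
"Statement-or-structure"): for every order `k`, tame-Christodoulou-generically on the admissible class,
an MGHD exists and every MGHD that does not already satisfy (complete 𝓘⁺ ∧ settles as the Statement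
demands) has complete 𝓘⁺ and carries a hyperboloidal Kerr-star foliation `Ψ` of order `k`
(`IsHypKerrFoliation`: bounded geometry, wave-time gauge) with rays in the closure of its image, on
which the LE-weighted leaf deviation `d_k` is RECURRENTLY small and the stationarity defect
`π = ∂₀(Ψ^* g)` has FINITE order-`(k+2)` local-energy size over the outer zones (near-horizon shell +
far zone) — the two-boundary budget.

## The cut (the route's TWO-LAYER PLAN for R, with the recurrence moved to the generic side)

R packs two things of different nature, and the skeleton separates them:

* `stub_recurrentKerrEra` (GENERIC, soft: censorship + gauge + "sub-extremal Kerr is in the ω-limit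
  set"): for every order `k`, generically, an MGHD exists and every non-settling MGHD has complete 𝓘⁺
  and an order-`k` hyperboloidal Kerr-star foliation in wave-time gauge with rays in the closure of its
  image on which `d_k ≤ ε` recurrently for every `ε > 0`.  This is R WITHOUT the budget conjunct.  It
  carries ALL the genericity of R (weak cosmic censorship; generic exclusion of extremal limits — the
  spin margin `χ < 1` is recurrent closeness to SUB-extremal Kerr, Kehle–Unger-type extremal final
  states are the exceptional set; generic exclusion of non-settling multi-hole ends; existence of a
  global bounded-geometry WAVE-TIME chart on the late exterior).  Genericity in Christodoulou's
  tame-codimension sense is not (evidently) closed under conjunction (the one-parameter family through a datum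
  failing `P₁ ∧ P₂` repairs `P₁` only), so exactly ONE stub may be generic; the other must hold for EVERY
  admissible datum and be spliced in by monotonicity of `IsTameChristodoulouGeneric` under pointwise
  implication on the admissible class (`isTameChristodoulouGeneric_mono`, proved below).  (The route's
  own two-layer plan put recurrence AND budgets on the deterministic side; as a statement about EVERY
  censored development carrying a bounded-geometry chart that is paper-false modulo extremal-Kerr
  formation in vacuum — `IsHypKerrFoliation` asks no closeness to Kerr — so recurrence, which is where
  sub-extremality `χ < 1` lives, is kept generic here.)  Nearest sibling: the multi-Kerr OmegaLimit
  device `Theses.ClusterCompleteness.OmegaLimitMultiKerr` (same Statement-or-structure shape, anchored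
  multi-chart interface instead of one hyperboloidal wave-time chart).
* `stub_outerBudgets` (DETERMINISTIC, hard analysis: the two-boundary budget): for every `k` there is an
  order `k'` such that for EVERY admissible datum, every maximal development with complete 𝓘⁺ and every
  order-`k'` foliation with rays and order-`k'` recurrence, EITHER the development already settles as
  the Statement demands, OR it carries a (re-based, possibly different) order-`k` foliation with rays,
  order-`k` recurrence and FINITE order-`(k+2)` outer-zone LE size of `π`.  Mechanism bet: `π = 𝓛_{∂₀} g`
  solves `□π = −2 Riem·π` exactly in the wave-time gauge (Fischer–Marsden–Moncrief 1980, Lemma 2.2;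
  `MetricCoord.IsMetricOn.tlap_deform_eq_of_tlap_eq_zero`), and integrated local energy decay OUTSIDE
  trapping loses no derivatives (red-shift near 𝓗⁺, `r^p`/Bondi flux near 𝓘⁺;
  DafermosRodnianskiShlapentokhrothman2014 §3.3, LindbladTohaneanu2020 Thm. 1), so on a recurrently
  near-Kerr bounded-geometry end the outer-zone LE size of `π` after a late re-basing time is bounded by
  a finite energy; the loss `k' ↦ k` pays for re-gauging the far leaves (outgoing-radiation decay
  `|∂₀g| = O(1/r)` is what makes the far-zone integrand `(1+‖y‖)⁻²|D^m π|²` integrable) and for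
  interpolation.  Why it might fail: higher-order (`k+2 ≥ 2`) budgets are NOT implied by Bondi mass loss
  plus bounded geometry (Σ_I a_I^θ may diverge for θ < 1), and on a merely RECURRENTLY near-Kerr end the
  background of the linear estimate drifts between the good times.  The disjunct "settles" keeps the
  stub honest on exactly stationary or already-settled developments (where no claim is needed) and is
  discharged in the composition against R's hypothesis `¬ (complete ∧ settles)`.

Composition `RecurrentKerrEraWithBudgets_of` (kernel-checked, no `sorry` of its own): fix `k`; take `k'`
from stub B; stub A at order `k'` gives the generic set; pointwise on the admissible class, a
non-settling MGHD is complete with an order-`k'` recurrent era (stub A), stub B re-bases it to order `k`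
with budgets (the "settles" branch contradicts the hypothesis since 𝓘⁺ is complete); monotonicity of
tame genericity concludes R BY NAME.

BC3 probes (planner folder `bc/probe_*.lean`, 2026-08-17): for each stub `S`,
`example : S → RecurrentKerrEraWithBudgets` and `example : S → FinalStateConjecture` by
`first | exact? | simpa [S] | (unfold S; simpa) | aesop` FAIL (no stub is cheaply the crux or the
summit); results quoted in `Lines/birth.md`.

Disproof used: none exists for this crux (no `Cruxes/RecurrentKerrEraWithBudgets/Disproof.lean`,
`ledger crux ls`: no workfiles, 2026-08-17T17:4xZ).  Negatives index: `UniformPhotonSphereChannels`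
(unrelated: no uniform-in-M channel is claimed here).
-/

namespace Summit.FinalStateConjecture.FinalStateConjecture.Cruxes.RecurrentKerrEraWithBudgets.Birth

open scoped BigOperators Topology Manifold Classical MeasureTheory ENNReal ContDiff
open Filter Set Function TopologicalSpace MeasureTheory
open Literature.Geometry.Lorentzian

/-! ## Monotonicity of tame Christodoulou genericity (the splice; proved) -/

/-- Tame Christodoulou genericity is monotone under pointwise implication on the admissible class:
the exceptional set of the weaker property is smaller, and the SAME one-parameter family works.
[folklore] -/
theorem isTameChristodoulouGeneric_mono {X : Type} [TopologicalSpace X] [ChartedSpace E3 X]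
    [IsManifold (𝓡 3) ∞ X] {𝓓 : Set (InitialDataSet (𝓡 3) X)}
    {P Q : InitialDataSet (𝓡 3) X → Prop} {m : ℕ}
    (hPQ : ∀ d ∈ 𝓓, P d → Q d) (h : InitialDataSet.IsTameChristodoulouGeneric 𝓓 P m) :
    InitialDataSet.IsTameChristodoulouGeneric 𝓓 Q m := by
  intro d hd
  obtain ⟨e, F, hF, hI, h0, hinj, hD, hE⟩ := h d ⟨hd.1, fun hp ↦ hd.2 (hPQ d hd.1 hp)⟩
  exact ⟨e, F, hF, hI, h0, hinj, hD, fun c hc hmem ↦ hE c hc ⟨hmem.1, fun hp ↦ hmem.2 (hPQ _ hmem.1 hp)⟩⟩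

/-! ## Statements of the two stubs as named propositions (the skeleton audit reads the hypotheses of
`RecurrentKerrEraWithBudgets_of` BY NAME: each head must be a declared stub, whence the `Goal.stub_*`
abbreviations). -/

/-- Statement of `stub_recurrentKerrEra` (GENERIC RECURRENT KERR ERA = R without the budget). -/
def RecurrentKerrEra : Prop := open Literature.Geometry.Lorentzian MeasureTheory Filter in open scoped ENNReal Manifold ContDiff in ∀ (k : ℕ) (X : Type) [TopologicalSpace X] [ChartedSpace E3 X] [IsManifold (𝓡 3) ∞ X] [T2Space X] [SecondCountableTopology X] [ConnectedSpace X], InitialDataSet.IsTameChristodoulouGeneric (admissibleVacuumData X) (fun D ↦ (∃ 𝒟 : VacuumCauchyDevelopment D, 𝒟.IsMaximal) ∧ ∀ 𝒟 : VacuumCauchyDevelopment D, 𝒟.IsMaximal → ¬ (Summit.FinalStateConjecture.HasCompleteNullInfinity 𝒟.toCauchyDevelopment ∧ (∃ (O : Set 𝒟.carrier) (d : FinalStateDecomposition 𝒟.toSpacetime O 2), (∀ i, Kerr.IsSubextremal (d.mass i) (d.spin i)) ∧ O = Summit.FinalStateConjecture.exteriorOf 𝒟.toCauchyDevelopment d.charted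 ∧ Summit.FinalStateConjecture.RaysStayInClosure 𝒟.toCauchyDevelopment O ∧ Summit.FinalStateConjecture.HasExhaustiveCharts d ∧ Summit.FinalStateConjecture.IsFutureOriented d)) → Summit.FinalStateConjecture.HasCompleteNullInfinity 𝒟.toCauchyDevelopment ∧ (∃ (Λ χ M₀ a₀ τ₀ : ℝ) (Ψ : (Kerr.hypStarBackground M₀ a₀).domain → 𝒟.carrier), 𝒟.toSpacetime.IsHypKerrFoliation k Λ χ M₀ a₀ τ₀ Ψ ∧ Summit.FinalStateConjecture.RaysStayInClosure 𝒟.toCauchyDevelopment (Summit.FinalStateConjecture.exteriorOf 𝒟.toCauchyDevelopment (Ψ '' (Kerr.hypStarBackground M₀ a₀).lateRegion τ₀)) ∧ (∀ ε : ℝ, 0 < ε → ∃ᶠ τ in atTop, 𝒟.toSpacetime.leafDev M₀ a₀ Ψ χ k τ ≤ ENNReal.ofReal ε))) 1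

/-- Statement of `stub_outerBudgets` (OUTER-ZONE TWO-BOUNDARY BUDGETS BY RE-BASING, every admissible
datum, "settles" as the honest escape). -/
def OuterBudgets : Prop := open Literature.Geometry.Lorentzian MeasureTheory Filter in open scoped ENNReal Manifold ContDiff in ∀ k : ℕ, ∃ k' : ℕ, ∀ (X : Type) [TopologicalSpace X] [ChartedSpace E3 X] [IsManifold (𝓡 3) ∞ X] [T2Space X] [SecondCountableTopology X] [ConnectedSpace X], ∀ D ∈ admissibleVacuumData X, ∀ (𝒟 : VacuumCauchyDevelopment D), 𝒟.IsMaximal → Summit.FinalStateConjecture.HasCompleteNullInfinity 𝒟.toCauchyDevelopment → ∀ (Λ χ M₀ a₀ τ₀ : ℝ) (Ψ : (Kerr.hypStarBackground M₀ a₀).domain → 𝒟.carrier), 𝒟.toSpacetime.IsHypKerrFoliation k' Λ χ M₀ a₀ τ₀ Ψ → Summit.FinalStateConjecture.RaysStayInClosure 𝒟.toCauchyDevelopment (Summit.FinalStateConjecture.exteriorOf 𝒟.toCauchyDevelopment (Ψ '' (Kerr.hypStarBackground M₀ a₀).lateRegion τ₀)) → (∀ ε : ℝ, 0 < ε → ∃ᶠ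 τ in atTop, 𝒟.toSpacetime.leafDev M₀ a₀ Ψ χ k' τ ≤ ENNReal.ofReal ε) → (∃ (O : Set 𝒟.carrier) (d : FinalStateDecomposition 𝒟.toSpacetime O 2), (∀ i, Kerr.IsSubextremal (d.mass i) (d.spin i)) ∧ O = Summit.FinalStateConjecture.exteriorOf 𝒟.toCauchyDevelopment d.charted ∧ Summit.FinalStateConjecture.RaysStayInClosure 𝒟.toCauchyDevelopment O ∧ Summit.FinalStateConjecture.HasExhaustiveCharts d ∧ Summit.FinalStateConjecture.IsFutureOriented d) ∨ (∃ (Λ' χ' M₀' a₀' τ₀' : ℝ) (Ψ' : (Kerr.hypStarBackground M₀' a₀').domain → 𝒟.carrier), 𝒟.toSpacetime.IsHypKerrFoliation k Λ' χ' M₀' a₀' τ₀' Ψ' ∧ Summit.FinalStateConjecture.RaysStayInClosure 𝒟.toCauchyDevelopment (Summit.FinalStateConjecture.exteriorOf 𝒟.toCauchyDevelopment (Ψ' '' (Kerr.hypStarBackground M₀' a₀').lateRegion τ₀')) ∧ (∀ ε : ℝ, 0 < ε → ∃ᶠ τ in atTop, 𝒟.toSpacetime.leafDev M₀' a₀' Ψ'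 χ' k τ ≤ ENNReal.ofReal ε) ∧ 𝒟.toSpacetime.defectLE (Kerr.hypStarBackground M₀' a₀') Ψ' (k + 2) (Set.Ioi τ₀') (Kerr.outerZones M₀' a₀') < ⊤)

namespace Goal
/-- Statement of `stub_recurrentKerrEra`, under the stub's name. -/
abbrev stub_recurrentKerrEra : Prop := RecurrentKerrEra
/-- Statement of `stub_outerBudgets`, under the stub's name. -/
abbrev stub_outerBudgets : Prop := OuterBudgets
end Goal

/-! ## Registered stubs, stated expanded (the only `sorry`s of the file) -/

/-- stub A — GENERIC RECURRENT KERR ERA (open; censorship + wave-time bounded-geometry chart + sub-extremal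
Kerr recurrently approached, generically): for every order `k`, tame-Christodoulou-generically on the
admissible class, an MGHD exists and every MGHD not already (complete ∧ settled) has complete 𝓘⁺ and an
order-`k` hyperboloidal Kerr-star foliation with rays in the closure of its image on which `d_k ≤ ε`
recurrently for every `ε > 0`.  Size XL (contains weak cosmic censorship).  Leans on:
`InitialDataSet.IsTameChristodoulouGeneric`, `Spacetime.IsHypKerrFoliation`, `Spacetime.leafDev`,
`RaysStayInClosure`, `exteriorOf`. -/
theorem stub_recurrentKerrEra : open Literature.Geometry.Lorentzian MeasureTheory Filter in open scoped ENNReal Manifold ContDiff in ∀ (k : ℕ) (X : Type) [TopologicalSpace X] [ChartedSpace E3 X] [IsManifold (𝓡 3) ∞ X] [T2Space X] [SecondCountableTopology X] [ConnectedSpace X], InitialDataSet.IsTameChristodoulouGeneric (admissibleVacuumData X) (fun D ↦ (∃ 𝒟 : VacuumCauchyDevelopment D, 𝒟.IsMaximal) ∧ ∀ 𝒟 : VacuumCauchyDevelopment D, 𝒟.IsMaximal → ¬ (Summit.FinalStateConjecture.HasCompleteNullInfinity 𝒟.toCauchyDevelopment ∧ (∃ (O : Set 𝒟.carrier) (d :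 FinalStateDecomposition 𝒟.toSpacetime O 2), (∀ i, Kerr.IsSubextremal (d.mass i) (d.spin i)) ∧ O = Summit.FinalStateConjecture.exteriorOf 𝒟.toCauchyDevelopment d.charted ∧ Summit.FinalStateConjecture.RaysStayInClosure 𝒟.toCauchyDevelopment O ∧ Summit.FinalStateConjecture.HasExhaustiveCharts d ∧ Summit.FinalStateConjecture.IsFutureOriented d)) → Summit.FinalStateConjecture.HasCompleteNullInfinity 𝒟.toCauchyDevelopment ∧ (∃ (Λ χ M₀ a₀ τ₀ : ℝ) (Ψ : (Kerr.hypStarBackground M₀ a₀).domain → 𝒟.carrier), 𝒟.toSpacetime.IsHypKerrFoliation k Λ χ M₀ a₀ τ₀ Ψ ∧ Summit.FinalStateConjecture.RaysStayInClosure 𝒟.toCauchyDevelopment (Summit.FinalStateConjecture.exteriorOf 𝒟.toCauchyDevelopment (Ψ '' (Kerr.hypStarBackground M₀ a₀).lateRegion τ₀)) ∧ (∀ ε : ℝ, 0 < ε → ∃ᶠ τ in atTop, 𝒟.toSpacetime.leafDev M₀ a₀ Ψ χ k τ ≤ ENNReal.ofReal ε))) 1 := by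
  sorry

/-- stub B — OUTER BUDGETS BY RE-BASING (open; deterministic): for every `k` there is `k'` such that for
every admissible datum, every maximal development with complete 𝓘⁺, and every order-`k'` hyperboloidal
Kerr-star foliation with rays and order-`k'` recurrence, either the development settles as the Statement
demands or it carries an order-`k` foliation with rays, order-`k` recurrence and finite order-`(k+2)`
outer-zone LE size of the stationarity defect.  Size XL (ILED outside trapping for the exact defect
field over infinite time on a drifting background; far-leaf re-gauging).  Leans on:
`Spacetime.defectLE`, `Kerr.outerZones`, `Spacetime.IsHypKerrFoliation`, `Spacetime.leafDev`,
`MetricCoord.IsMetricOn.tlap_deform_eq_of_tlap_eq_zero` (for the proof, not the statement). -/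
theorem stub_outerBudgets : open Literature.Geometry.Lorentzian MeasureTheory Filter in open scoped ENNReal Manifold ContDiff in ∀ k : ℕ, ∃ k' : ℕ, ∀ (X : Type) [TopologicalSpace X] [ChartedSpace E3 X] [IsManifold (𝓡 3) ∞ X] [T2Space X] [SecondCountableTopology X] [ConnectedSpace X], ∀ D ∈ admissibleVacuumData X, ∀ (𝒟 : VacuumCauchyDevelopment D), 𝒟.IsMaximal → Summit.FinalStateConjecture.HasCompleteNullInfinity 𝒟.toCauchyDevelopment → ∀ (Λ χ M₀ a₀ τ₀ : ℝ) (Ψ : (Kerr.hypStarBackground M₀ a₀).domain → 𝒟.carrier), 𝒟.toSpacetime.IsHypKerrFoliation k' Λ χ M₀ a₀ τ₀ Ψ → Summit.FinalStateConjecture.RaysStayInClosure 𝒟.toCauchyDevelopment (Summit.FinalStateConjecture.exteriorOf 𝒟.toCauchyDevelopment (Ψ '' (Kerr.hypStarBackground M₀ a₀).lateRegion τ₀)) → (∀ ε : ℝ, 0 < ε → ∃ᶠ τ in atTop, 𝒟.toSpacetime.leafDev M₀ a₀ Ψ χ k' τ ≤ ENNReal.ofReal ε) → (∃ (O : Set 𝒟.carrier)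 (d : FinalStateDecomposition 𝒟.toSpacetime O 2), (∀ i, Kerr.IsSubextremal (d.mass i) (d.spin i)) ∧ O = Summit.FinalStateConjecture.exteriorOf 𝒟.toCauchyDevelopment d.charted ∧ Summit.FinalStateConjecture.RaysStayInClosure 𝒟.toCauchyDevelopment O ∧ Summit.FinalStateConjecture.HasExhaustiveCharts d ∧ Summit.FinalStateConjecture.IsFutureOriented d) ∨ (∃ (Λ' χ' M₀' a₀' τ₀' : ℝ) (Ψ' : (Kerr.hypStarBackground M₀' a₀').domain → 𝒟.carrier), 𝒟.toSpacetime.IsHypKerrFoliation k Λ' χ' M₀' a₀' τ₀' Ψ' ∧ Summit.FinalStateConjecture.RaysStayInClosure 𝒟.toCauchyDevelopment (Summit.FinalStateConjecture.exteriorOf 𝒟.toCauchyDevelopment (Ψ' '' (Kerr.hypStarBackground M₀' a₀').lateRegion τ₀')) ∧ (∀ ε : ℝ, 0 < ε → ∃ᶠ τ in atTop, 𝒟.toSpacetime.leafDev M₀' a₀' Ψ' χ' k τ ≤ ENNReal.ofReal ε) ∧ 𝒟.toSpacetime.defectLE (Kerr.hypStarBackground M₀' a₀') Ψ' (k + 2)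 (Set.Ioi τ₀') (Kerr.outerZones M₀' a₀') < ⊤) := by
  sorry

/-! Consistency (elaborated, not kept in the environment): the expanded stubs ARE the named statements. -/
example : Goal.stub_recurrentKerrEra := stub_recurrentKerrEra
example : Goal.stub_outerBudgets := stub_outerBudgets

/-! ## The composition (kernel-checked; no `sorry` of its own) -/

/-- THE CRUX BY NAME from the two stubs: fix `k`, take `k'` from stub B, apply stub A at order `k'`, and
splice pointwise on the admissible class (a non-settling MGHD is complete with an order-`k'` recurrent
era; stub B re-bases it — its "settles" branch is absurd against the hypothesis; tame genericity is
monotone). -/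
theorem RecurrentKerrEraWithBudgets_of :
    Goal.stub_recurrentKerrEra → Goal.stub_outerBudgets →
      Summit.FinalStateConjecture.FinalStateConjecture.Theses.KillingDefectSpacetimeBound.RecurrentKerrEraWithBudgets := by
  intro hA hB k X _ _ _ _ _ _
  obtain ⟨k', hk'⟩ := hB k
  have hgen := hA k' X
  refine isTameChristodoulouGeneric_mono ?_ hgen
  intro D hD hP
  obtain ⟨hex, hall⟩ := hP
  refine ⟨hex, fun 𝒟 hmax hnot ↦ ?_⟩
  obtain ⟨hcomp, Λ, χ, M₀, a₀, τ₀, Ψ, hΨ, hrays, hrec⟩ := hall 𝒟 hmax hnot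
  refine ⟨hcomp, ?_⟩
  rcases hk' X D hD 𝒟 hmax hcomp Λ χ M₀ a₀ τ₀ Ψ hΨ hrays hrec with hset | hreb
  · exact absurd ⟨hcomp, hset⟩ hnot
  · exact hreb

end Summit.FinalStateConjecture.FinalStateConjecture.Cruxes.RecurrentKerrEraWithBudgets.Birth
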